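import Mathlib
import HarnessLib
import Summits.Ventures.LatticeQCDFlow.Exactness.SU2FTHMCGaugeCovariance
import Summits.Ventures.LatticeQCDFlow.Exactness.SU2FixedPointInverse

/-!
# The EXACT force of any gauge-invariant pulled-back action is `Ad`-covariant — so the `SU(2)` FT-HMC kernel with the exact-gradient force routine commutes with every gauge transformation, no force hypothesis left

HONEST FRAMING: exact (Metropolis-corrected) sampling algorithms for lattice gauge theory;
figures of merit are autocorrelation/cost numbers at stated couplings and volumes; no
continuum-physics claim.

Venture `LatticeQCDFlow` (cell pub-lqcd), topic `Exactness`; FANOUT row 14 (`eng-flowhmc`, engine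
`latflow.fthmc` on the `SU(2)` rung: the force routine is the AUTODIFF GRADIENT of the pulled-back
action `S̃(V) = S(F V) − log J(V)` along the drift `U_ℓ ← exp(c P_ℓ) U_ℓ`).  NEW WORK of the cell;
nothing is cited as a fact; no number.  `SU2FTHMCGaugeCovariance.su2_fthmc_conjKernel_gaugeTransform`
keeps one hypothesis on the force routine `g`: covariance `g (V^h) = R_h (g V)` (`R_h = Ad_h` on the
momenta, `SU2MomentumRotation`).  Here it is DISCHARGED for the exact force, in exact arithmetic:
the routine `g_κ V (q) = κ · D(p ↦ S̃(exp(c p) · V))(0) · e_q` — the Fréchet derivative at `p = 0`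
of the action along the engine's own drift, read on the coordinate vectors `e_q = Pi.single q 1`
of `(Edge × Fin 3) → ℝ`, times any real constant (Mathlib's `fderiv`, which is `0` where the map is
not differentiable — so no differentiability hypothesis is needed for covariance):

* `R_h` bookkeeping (explicit expressions, continuing `SU2MomentumRotation`): `sum_mul_su2MomRot`
  (`R_h` preserves the Euclidean inner product — polarisation of `sum_sq_su2MomRot`),
  `su2MomRot_inv_single` (`R_{h⁻¹}` is the transpose of `R_h` on coordinate vectors),
  `su2MomRot_apply_eq_sum` (matrix form of `R_h w`);
* `su2Drift_mul_gaugeTransform_eq` — `exp(c p) · V^h = (exp(c R_{h⁻¹} p) · V)^h`; hence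
  **`ftAction_drift_gaugeTransform`**: for gauge-invariant `S̃`,
  `p ↦ S̃(exp(c p) · V^h)` IS `p ↦ S̃(exp(c p) · V)` precomposed with the linear isometry `R_{h⁻¹}`;
* **`su2ExactForce_gaugeTransform`** — THE EXACT FORCE IS COVARIANT: `g_κ (V^h) = R_h (g_κ V)` for
  every gauge-invariant `S̃ : GaugeConfig → ℝ` whatsoever, every `c`, `κ`, `h`, `V` (chain rule
  through the continuous linear equivalence `R_{h⁻¹}`, `ContinuousLinearEquiv.comp_right_fderiv`,
  and `R_{h⁻¹} = R_hᵀ`);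
* `continuous_su2Drift`, **`measurable_su2ExactForce`** — for continuous `S̃` the exact force
  routine is measurable in the field (Mathlib's `measurable_fderiv_apply_const_with_param`);
* **`su2_fthmc_exactForce_conjKernel_gaugeTransform`** — the engine's `SU(2)` FT-HMC kernel
  driven by the exact force of `S̃ = S∘F − log J` (gauge-equivariant member `F`, gauge-invariant
  `J`, `S`, with `S̃` continuous) commutes with every gauge transformation `Θ_h`: the covariance
  hypothesis of `su2_fthmc_conjKernel_gaugeTransform` is discharged by
  `su2ExactForce_gaugeTransform` + `isGaugeInvariant_ftAction`.

NOT CLAIMED: that floating-point reverse-mode autodiff returns `fderiv` exactly (it does in exact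
arithmetic for the straight-line programs the engine differentiates; rounding is not typed); the
normalisation `κ` / basis conventions of the engine's su(2) coordinates; `SU(N ≥ 3)`; any number.
-/

noncomputable section

namespace Summit.Ventures.LatticeQCDFlow.Exactness

open WithLp Set MeasureTheory
open ProbabilityTheory ProbabilityTheory.Kernel
open Literature.MathematicalPhysics.QuantumFieldTheory Literature.Barriers.QuantumFields
open scoped ENNReal Matrix

/-! ## More on `R_h`: inner products, transpose, matrix form -/

section Rot

variable {d L : ℕ} [NeZero L]

/-- `Σ (a+b)² = Σ a² + 2 Σ ab + Σ b²` on `(Edge × Fin 3) → ℝ`. -/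
theorem sum_add_sq_expand (a b : ((Edge d L × Fin 3) → ℝ)) :
    ∑ q : Edge d L × Fin 3, (a + b) q ^ 2 = ∑ q : Edge d L × Fin 3, a q ^ 2 + 2 * ∑ q : Edge d L × Fin 3, a q * b q + ∑ q : Edge d L × Fin 3, b q ^ 2 := by
  rw [Finset.mul_sum, ← Finset.sum_add_distrib, ← Finset.sum_add_distrib]
  exact Finset.sum_congr rfl fun q _ => by rw [Pi.add_apply]; ring

/-- **`R_h` preserves the Euclidean inner product** `Σ_q u_q v_q` (polarisation of `sum_sq_su2MomRot`). -/
theorem sum_mul_su2MomRot (h : Site d L → Matrix.specialUnitaryGroup (Fin 2) ℂ) (u v : ((Edge d L × Fin 3) → ℝ)) :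
    ∑ q : Edge d L × Fin 3, (fun q : Edge d L × Fin 3 => (vecQuat (((h q.1.1 : Matrix.specialUnitaryGroup (Fin 2) ℂ) : Matrix (Fin 2) (Fin 2) ℂ) * quatVec (toLp 2 ![0, u (q.1, 0), u (q.1, 1), u (q.1, 2)]) * (((h q.1.1 : Matrix.specialUnitaryGroup (Fin 2) ℂ) : Matrix (Fin 2) (Fin 2) ℂ))ᴴ)) q.2.succ) q * (fun q : Edge d L × Fin 3 => (vecQuat (((h q.1.1 : Matrix.specialUnitaryGroup (Fin 2) ℂ) : Matrix (Fin 2) (Fin 2) ℂ) * quatVec (toLp 2 ![0, v (q.1, 0), v (q.1, 1), v (q.1, 2)]) * (((h q.1.1 : Matrix.specialUnitaryGroup (Fin 2) ℂ) : Matrix (Fin 2) (Fin 2) ℂ))ᴴ)) q.2.succ) q = ∑ q : Edge d L × Fin 3, u q * v q := by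
  have hu := sum_sq_su2MomRot h u
  have hv := sum_sq_su2MomRot h v
  have huv := sum_sq_su2MomRot h (u + v)
  rw [su2MomRot_add, sum_add_sq_expand, sum_add_sq_expand] at huv
  linarith

/-- `Σ_y u(y) e_x(y) = u(x)`. -/
theorem sum_mul_single_one_momentum (u : ((Edge d L × Fin 3) → ℝ)) (x : Edge d L × Fin 3) :
    ∑ y : Edge d L × Fin 3, u y * (Pi.single x (1 : ℝ) : ((Edge d L × Fin 3) → ℝ)) y = u x := by
  rw [Finset.sum_eq_single x (fun y _ hy => by rw [Pi.single_eq_of_ne hy, mul_zero])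
    (fun h => absurd (Finset.mem_univ x) h), Pi.single_eq_same, mul_one]

/-- `Σ_y e_x(y) u(y) = u(x)`. -/
theorem sum_single_one_mul_momentum (u : ((Edge d L × Fin 3) → ℝ)) (x : Edge d L × Fin 3) :
    ∑ y : Edge d L × Fin 3, (Pi.single x (1 : ℝ) : ((Edge d L × Fin 3) → ℝ)) y * u y = u x := by
  rw [Finset.sum_eq_single x (fun y _ hy => by rw [Pi.single_eq_of_ne hy, zero_mul])
    (fun h => absurd (Finset.mem_univ x) h), Pi.single_eq_same, one_mul]

/-- **`R_(h⁻¹)` is the transpose of `R_h`**: `(R_(h⁻¹) e_a)(b) = (R_h e_b)(a)` on the coordinate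
vectors `e_a = Pi.single a 1`. -/
theorem su2MomRot_inv_single (h : Site d L → Matrix.specialUnitaryGroup (Fin 2) ℂ) (a b : Edge d L × Fin 3) :
    vecQuat (((h⁻¹ b.1.1 : Matrix.specialUnitaryGroup (Fin 2) ℂ) : Matrix (Fin 2) (Fin 2) ℂ) * quatVec (toLp 2 ![0, (Pi.single a (1 : ℝ) : ((Edge d L × Fin 3) → ℝ)) (b.1, 0), (Pi.single a (1 : ℝ) : ((Edge d L × Fin 3) → ℝ)) (b.1, 1), (Pi.single a (1 : ℝ) : ((Edge d L × Fin 3) → ℝ)) (b.1, 2)]) * (((h⁻¹ b.1.1 : Matrix.specialUnitaryGroup (Fin 2) ℂ) : Matrix (Fin 2) (Fin 2) ℂ))ᴴ) b.2.succ =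
      vecQuat (((h a.1.1 : Matrix.specialUnitaryGroup (Fin 2) ℂ) : Matrix (Fin 2) (Fin 2) ℂ) * quatVec (toLp 2 ![0, (Pi.single b (1 : ℝ) : ((Edge d L × Fin 3) → ℝ)) (a.1, 0), (Pi.single b (1 : ℝ) : ((Edge d L × Fin 3) → ℝ)) (a.1, 1), (Pi.single b (1 : ℝ) : ((Edge d L × Fin 3) → ℝ)) (a.1, 2)]) * (((h a.1.1 : Matrix.specialUnitaryGroup (Fin 2) ℂ) : Matrix (Fin 2) (Fin 2) ℂ))ᴴ) a.2.succ := by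
  have h1 := sum_mul_su2MomRot h (Pi.single b (1 : ℝ) : ((Edge d L × Fin 3) → ℝ))
    (fun q : Edge d L × Fin 3 => (vecQuat (((h⁻¹ q.1.1 : Matrix.specialUnitaryGroup (Fin 2) ℂ) : Matrix (Fin 2) (Fin 2) ℂ) * quatVec (toLp 2 ![0, (Pi.single a (1 : ℝ) : ((Edge d L × Fin 3) → ℝ)) (q.1, 0), (Pi.single a (1 : ℝ) : ((Edge d L × Fin 3) → ℝ)) (q.1, 1), (Pi.single a (1 : ℝ) : ((Edge d L × Fin 3) → ℝ)) (q.1, 2)]) * (((h⁻¹ q.1.1 : Matrix.specialUnitaryGroup (Fin 2) ℂ) : Matrix (Fin 2) (Fin 2) ℂ))ᴴ)) q.2.succ)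
  rw [su2MomRot_inv_right h (Pi.single a (1 : ℝ) : ((Edge d L × Fin 3) → ℝ)), sum_mul_single_one_momentum,
    sum_single_one_mul_momentum] at h1
  exact h1.symm

/-- **Matrix form of `R_h`**: `(R_h w)(a) = Σ_b w(b) · (R_h e_b)(a)`. -/
theorem su2MomRot_apply_eq_sum (h : Site d L → Matrix.specialUnitaryGroup (Fin 2) ℂ) (w : ((Edge d L × Fin 3) → ℝ)) (a : Edge d L × Fin 3) :
    vecQuat (((h a.1.1 : Matrix.specialUnitaryGroup (Fin 2) ℂ) : Matrix (Fin 2) (Fin 2) ℂ) * quatVec (toLp 2 ![0, w (a.1, 0), w (a.1, 1), w (a.1, 2)]) * (((h a.1.1 : Matrix.specialUnitaryGroup (Fin 2) ℂ) : Matrix (Fin 2) (Fin 2) ℂ))ᴴ) a.2.succ =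
      ∑ b : Edge d L × Fin 3, w b * vecQuat (((h a.1.1 : Matrix.specialUnitaryGroup (Fin 2) ℂ) : Matrix (Fin 2) (Fin 2) ℂ) * quatVec (toLp 2 ![0, (Pi.single b (1 : ℝ) : ((Edge d L × Fin 3) → ℝ)) (a.1, 0), (Pi.single b (1 : ℝ) : ((Edge d L × Fin 3) → ℝ)) (a.1, 1), (Pi.single b (1 : ℝ) : ((Edge d L × Fin 3) → ℝ)) (a.1, 2)]) * (((h a.1.1 : Matrix.specialUnitaryGroup (Fin 2) ℂ) : Matrix (Fin 2) (Fin 2) ℂ))ᴴ) a.2.succ := by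
  let Lh : ((Edge d L × Fin 3) → ℝ) →ₗ[ℝ] ((Edge d L × Fin 3) → ℝ) :=
    { toFun := fun p => (fun q : Edge d L × Fin 3 => (vecQuat (((h q.1.1 : Matrix.specialUnitaryGroup (Fin 2) ℂ) : Matrix (Fin 2) (Fin 2) ℂ) * quatVec (toLp 2 ![0, p (q.1, 0), p (q.1, 1), p (q.1, 2)]) * (((h q.1.1 : Matrix.specialUnitaryGroup (Fin 2) ℂ) : Matrix (Fin 2) (Fin 2) ℂ))ᴴ)) q.2.succ)
      map_add' := fun p p' => su2MomRot_add h p p'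
      map_smul' := fun r p => su2MomRot_smul h r p }
  change Lh w a = _
  conv_lhs => rw [pi_eq_sum_univ' w, map_sum]
  rw [Finset.sum_apply]
  refine Finset.sum_congr rfl fun b _ => ?_
  rw [map_smul, Pi.smul_apply, smul_eq_mul]
  rfl

end Rot

/-! ## The action along the drift, seen from a transformed field -/

section Drift

variable {d L : ℕ} [NeZero L]

omit [NeZero L] in
/-- `exp(c p) · V^h = (exp(c R_(h⁻¹) p) · V)^h`. -/
theorem su2Drift_mul_gaugeTransform_eq (h : Site d L → Matrix.specialUnitaryGroup (Fin 2) ℂ) (c : ℝ) (p : ((Edge d L × Fin 3) → ℝ)) (V : GaugeConfig d L (Matrix.specialUnitaryGroup (Fin 2) ℂ)) :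
    (fun ℓ : Edge d L => gaussUnit (toLp 2
          ![Real.cos (c * Real.sqrt (p (ℓ, 0) ^ 2 + p (ℓ, 1) ^ 2 + p (ℓ, 2) ^ 2)),
            c * Real.sinc (c * Real.sqrt (p (ℓ, 0) ^ 2 + p (ℓ, 1) ^ 2 + p (ℓ, 2) ^ 2)) * p (ℓ, 0),
            c * Real.sinc (c * Real.sqrt (p (ℓ, 0) ^ 2 + p (ℓ, 1) ^ 2 + p (ℓ, 2) ^ 2)) * p (ℓ, 1),
            c * Real.sinc (c * Real.sqrt (p (ℓ, 0) ^ 2 + p (ℓ, 1) ^ 2 + p (ℓ, 2) ^ 2)) * p (ℓ, 2)])) * gaugeTransform h V =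
      gaugeTransform h ((fun ℓ : Edge d L => gaussUnit (toLp 2
          ![Real.cos (c * Real.sqrt ((fun q : Edge d L × Fin 3 => (vecQuat (((h⁻¹ q.1.1 : Matrix.specialUnitaryGroup (Fin 2) ℂ) : Matrix (Fin 2) (Fin 2) ℂ) * quatVec (toLp 2 ![0, p (q.1, 0), p (q.1, 1), p (q.1, 2)]) * (((h⁻¹ q.1.1 : Matrix.specialUnitaryGroup (Fin 2) ℂ) : Matrix (Fin 2) (Fin 2) ℂ))ᴴ)) q.2.succ) (ℓ, 0) ^ 2 + (fun q : Edge d L × Fin 3 => (vecQuat (((h⁻¹ q.1.1 : Matrix.specialUnitaryGroup (Fin 2) ℂ) : Matrix (Fin 2) (Fin 2) ℂ) * quatVec (toLp 2 ![0, p (q.1, 0), p (q.1, 1), p (q.1, 2)]) * (((h⁻¹ q.1.1 : Matrix.specialUnitaryGroup (Fin 2) ℂ) : Matrix (Fin 2) (Fin 2) ℂ))ᴴ)) q.2.succ) (ℓ, 1) ^ 2 + (fun q : Edge d L × Fin 3 => (vecQuat (((h⁻¹ q.1.1 : Matrix.specialUnitaryGroup (Fin 2) ℂ) : Matrix (Fin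 2) (Fin 2) ℂ) * quatVec (toLp 2 ![0, p (q.1, 0), p (q.1, 1), p (q.1, 2)]) * (((h⁻¹ q.1.1 : Matrix.specialUnitaryGroup (Fin 2) ℂ) : Matrix (Fin 2) (Fin 2) ℂ))ᴴ)) q.2.succ) (ℓ, 2) ^ 2)),
            c * Real.sinc (c * Real.sqrt ((fun q : Edge d L × Fin 3 => (vecQuat (((h⁻¹ q.1.1 : Matrix.specialUnitaryGroup (Fin 2) ℂ) : Matrix (Fin 2) (Fin 2) ℂ) * quatVec (toLp 2 ![0, p (q.1, 0), p (q.1, 1), p (q.1, 2)]) * (((h⁻¹ q.1.1 : Matrix.specialUnitaryGroup (Fin 2) ℂ) : Matrix (Fin 2) (Fin 2) ℂ))ᴴ)) q.2.succ) (ℓ, 0) ^ 2 + (fun q : Edge d L × Fin 3 => (vecQuat (((h⁻¹ q.1.1 : Matrix.specialUnitaryGroup (Fin 2) ℂ) : Matrix (Fin 2) (Fin 2) ℂ) * quatVec (toLp 2 ![0, p (q.1, 0), p (q.1, 1), p (q.1, 2)]) * (((h⁻¹ q.1.1 : Matrix.specialUnitaryGroup (Fin 2) ℂ) : Matrix (Fin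 2) (Fin 2) ℂ))ᴴ)) q.2.succ) (ℓ, 1) ^ 2 + (fun q : Edge d L × Fin 3 => (vecQuat (((h⁻¹ q.1.1 : Matrix.specialUnitaryGroup (Fin 2) ℂ) : Matrix (Fin 2) (Fin 2) ℂ) * quatVec (toLp 2 ![0, p (q.1, 0), p (q.1, 1), p (q.1, 2)]) * (((h⁻¹ q.1.1 : Matrix.specialUnitaryGroup (Fin 2) ℂ) : Matrix (Fin 2) (Fin 2) ℂ))ᴴ)) q.2.succ) (ℓ, 2) ^ 2)) * (fun q : Edge d L × Fin 3 => (vecQuat (((h⁻¹ q.1.1 : Matrix.specialUnitaryGroup (Fin 2) ℂ) : Matrix (Fin 2) (Fin 2) ℂ) * quatVec (toLp 2 ![0, p (q.1, 0), p (q.1, 1), p (q.1, 2)]) * (((h⁻¹ q.1.1 : Matrix.specialUnitaryGroup (Fin 2) ℂ) : Matrix (Fin 2) (Fin 2) ℂ))ᴴ)) q.2.succ) (ℓ, 0),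
            c * Real.sinc (c * Real.sqrt ((fun q : Edge d L × Fin 3 => (vecQuat (((h⁻¹ q.1.1 : Matrix.specialUnitaryGroup (Fin 2) ℂ) : Matrix (Fin 2) (Fin 2) ℂ) * quatVec (toLp 2 ![0, p (q.1, 0), p (q.1, 1), p (q.1, 2)]) * (((h⁻¹ q.1.1 : Matrix.specialUnitaryGroup (Fin 2) ℂ) : Matrix (Fin 2) (Fin 2) ℂ))ᴴ)) q.2.succ) (ℓ, 0) ^ 2 + (fun q : Edge d L × Fin 3 => (vecQuat (((h⁻¹ q.1.1 : Matrix.specialUnitaryGroup (Fin 2) ℂ) : Matrix (Fin 2) (Fin 2) ℂ) * quatVec (toLp 2 ![0, p (q.1, 0), p (q.1, 1), p (q.1, 2)]) * (((h⁻¹ q.1.1 : Matrix.specialUnitaryGroup (Fin 2) ℂ) : Matrix (Fin 2) (Fin 2) ℂ))ᴴ)) q.2.succ) (ℓ, 1) ^ 2 + (fun q : Edge d L × Fin 3 => (vecQuat (((h⁻¹ q.1.1 : Matrix.specialUnitaryGroup (Fin 2) ℂ) : Matrix (Fin 2) (Fin 2) ℂ) * quatVec (toLp 2 ![0, p (q.1,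 0), p (q.1, 1), p (q.1, 2)]) * (((h⁻¹ q.1.1 : Matrix.specialUnitaryGroup (Fin 2) ℂ) : Matrix (Fin 2) (Fin 2) ℂ))ᴴ)) q.2.succ) (ℓ, 2) ^ 2)) * (fun q : Edge d L × Fin 3 => (vecQuat (((h⁻¹ q.1.1 : Matrix.specialUnitaryGroup (Fin 2) ℂ) : Matrix (Fin 2) (Fin 2) ℂ) * quatVec (toLp 2 ![0, p (q.1, 0), p (q.1, 1), p (q.1, 2)]) * (((h⁻¹ q.1.1 : Matrix.specialUnitaryGroup (Fin 2) ℂ) : Matrix (Fin 2) (Fin 2) ℂ))ᴴ)) q.2.succ) (ℓ, 1),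
            c * Real.sinc (c * Real.sqrt ((fun q : Edge d L × Fin 3 => (vecQuat (((h⁻¹ q.1.1 : Matrix.specialUnitaryGroup (Fin 2) ℂ) : Matrix (Fin 2) (Fin 2) ℂ) * quatVec (toLp 2 ![0, p (q.1, 0), p (q.1, 1), p (q.1, 2)]) * (((h⁻¹ q.1.1 : Matrix.specialUnitaryGroup (Fin 2) ℂ) : Matrix (Fin 2) (Fin 2) ℂ))ᴴ)) q.2.succ) (ℓ, 0) ^ 2 + (fun q : Edge d L × Fin 3 => (vecQuat (((h⁻¹ q.1.1 : Matrix.specialUnitaryGroup (Fin 2) ℂ) : Matrix (Fin 2) (Fin 2) ℂ) * quatVec (toLp 2 ![0, p (q.1, 0), p (q.1, 1), p (q.1, 2)]) * (((h⁻¹ q.1.1 : Matrix.specialUnitaryGroup (Fin 2) ℂ) : Matrix (Fin 2) (Fin 2) ℂ))ᴴ)) q.2.succ) (ℓ, 1) ^ 2 + (fun q : Edge d L × Fin 3 => (vecQuat (((h⁻¹ q.1.1 : Matrix.specialUnitaryGroup (Fin 2) ℂ) : Matrix (Fin 2) (Fin 2) ℂ) * quatVec (toLp 2 ![0, p (q.1,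 0), p (q.1, 1), p (q.1, 2)]) * (((h⁻¹ q.1.1 : Matrix.specialUnitaryGroup (Fin 2) ℂ) : Matrix (Fin 2) (Fin 2) ℂ))ᴴ)) q.2.succ) (ℓ, 2) ^ 2)) * (fun q : Edge d L × Fin 3 => (vecQuat (((h⁻¹ q.1.1 : Matrix.specialUnitaryGroup (Fin 2) ℂ) : Matrix (Fin 2) (Fin 2) ℂ) * quatVec (toLp 2 ![0, p (q.1, 0), p (q.1, 1), p (q.1, 2)]) * (((h⁻¹ q.1.1 : Matrix.specialUnitaryGroup (Fin 2) ℂ) : Matrix (Fin 2) (Fin 2) ℂ))ᴴ)) q.2.succ) (ℓ, 2)])) * V) := by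
  have key := su2Drift_su2MomRot_mul_gaugeTransform h c (fun q : Edge d L × Fin 3 => (vecQuat (((h⁻¹ q.1.1 : Matrix.specialUnitaryGroup (Fin 2) ℂ) : Matrix (Fin 2) (Fin 2) ℂ) * quatVec (toLp 2 ![0, p (q.1, 0), p (q.1, 1), p (q.1, 2)]) * (((h⁻¹ q.1.1 : Matrix.specialUnitaryGroup (Fin 2) ℂ) : Matrix (Fin 2) (Fin 2) ℂ))ᴴ)) q.2.succ) V
  rw [su2MomRot_inv_right h p] at key
  exact key

omit [NeZero L] in
/-- **For a gauge-invariant `S̃`, the action along the drift from `V^h` is the action along the drift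
from `V` precomposed with `R_(h⁻¹)`**: `S̃(exp(c p) · V^h) = S̃(exp(c R_(h⁻¹) p) · V)`. -/
theorem ftAction_drift_gaugeTransform (h : Site d L → Matrix.specialUnitaryGroup (Fin 2) ℂ) {St : GaugeConfig d L (Matrix.specialUnitaryGroup (Fin 2) ℂ) → ℝ} (hSt : IsGaugeInvariant St)
    (c : ℝ) (V : GaugeConfig d L (Matrix.specialUnitaryGroup (Fin 2) ℂ)) :
    (fun p : ((Edge d L × Fin 3) → ℝ) => St ((fun ℓ : Edge d L => gaussUnit (toLp 2
          ![Real.cos (c * Real.sqrt (p (ℓ, 0) ^ 2 + p (ℓ, 1) ^ 2 + p (ℓ, 2) ^ 2)),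
            c * Real.sinc (c * Real.sqrt (p (ℓ, 0) ^ 2 + p (ℓ, 1) ^ 2 + p (ℓ, 2) ^ 2)) * p (ℓ, 0),
            c * Real.sinc (c * Real.sqrt (p (ℓ, 0) ^ 2 + p (ℓ, 1) ^ 2 + p (ℓ, 2) ^ 2)) * p (ℓ, 1),
            c * Real.sinc (c * Real.sqrt (p (ℓ, 0) ^ 2 + p (ℓ, 1) ^ 2 + p (ℓ, 2) ^ 2)) * p (ℓ, 2)])) * gaugeTransform h V)) =
      (fun p : ((Edge d L × Fin 3) → ℝ) => St ((fun ℓ : Edge d L => gaussUnit (toLp 2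
          ![Real.cos (c * Real.sqrt (p (ℓ, 0) ^ 2 + p (ℓ, 1) ^ 2 + p (ℓ, 2) ^ 2)),
            c * Real.sinc (c * Real.sqrt (p (ℓ, 0) ^ 2 + p (ℓ, 1) ^ 2 + p (ℓ, 2) ^ 2)) * p (ℓ, 0),
            c * Real.sinc (c * Real.sqrt (p (ℓ, 0) ^ 2 + p (ℓ, 1) ^ 2 + p (ℓ, 2) ^ 2)) * p (ℓ, 1),
            c * Real.sinc (c * Real.sqrt (p (ℓ, 0) ^ 2 + p (ℓ, 1) ^ 2 + p (ℓ, 2) ^ 2)) * p (ℓ, 2)])) * V)) ∘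
        (fun p : ((Edge d L × Fin 3) → ℝ) => (fun q : Edge d L × Fin 3 => (vecQuat (((h⁻¹ q.1.1 : Matrix.specialUnitaryGroup (Fin 2) ℂ) : Matrix (Fin 2) (Fin 2) ℂ) * quatVec (toLp 2 ![0, p (q.1, 0), p (q.1, 1), p (q.1, 2)]) * (((h⁻¹ q.1.1 : Matrix.specialUnitaryGroup (Fin 2) ℂ) : Matrix (Fin 2) (Fin 2) ℂ))ᴴ)) q.2.succ)) := by
  funext p
  rw [Function.comp_apply, su2Drift_mul_gaugeTransform_eq h c p V, hSt h]

end Drift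

/-! ## The exact force is covariant -/

section Force

variable {d L : ℕ} [NeZero L]

/-- **The exact force of a gauge-invariant action is `Ad`-covariant.**  For EVERY gauge-invariant
`S̃ : GaugeConfig d L SU(2) → ℝ`, every `c κ : ℝ`, every gauge transformation `h` and field `V`:
with `g_κ V (q) = κ · fderiv ℝ (p ↦ S̃(exp(c p) · V)) 0 (e_q)`,
`g_κ (V^h) = R_h (g_κ V)` — the hypothesis `hgc` of `su2_fthmc_conjKernel_gaugeTransform`. -/
theorem su2ExactForce_gaugeTransform (h : Site d L → Matrix.specialUnitaryGroup (Fin 2) ℂ) {St : GaugeConfig d L (Matrix.specialUnitaryGroup (Fin 2) ℂ) → ℝ} (hSt : IsGaugeInvariant St)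
    (c κ : ℝ) (V : GaugeConfig d L (Matrix.specialUnitaryGroup (Fin 2) ℂ)) :
    (fun q : Edge d L × Fin 3 => κ * fderiv ℝ (fun p : ((Edge d L × Fin 3) → ℝ) => St ((fun ℓ : Edge d L => gaussUnit (toLp 2
          ![Real.cos (c * Real.sqrt (p (ℓ, 0) ^ 2 + p (ℓ, 1) ^ 2 + p (ℓ, 2) ^ 2)),
            c * Real.sinc (c * Real.sqrt (p (ℓ, 0) ^ 2 + p (ℓ, 1) ^ 2 + p (ℓ, 2) ^ 2)) * p (ℓ, 0),
            c * Real.sinc (c * Real.sqrt (p (ℓ, 0) ^ 2 + p (ℓ, 1) ^ 2 + p (ℓ, 2) ^ 2)) * p (ℓ, 1),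
            c * Real.sinc (c * Real.sqrt (p (ℓ, 0) ^ 2 + p (ℓ, 1) ^ 2 + p (ℓ, 2) ^ 2)) * p (ℓ, 2)])) * gaugeTransform h V)) 0 (Pi.single q 1)) =
      (fun q : Edge d L × Fin 3 => (vecQuat (((h q.1.1 : Matrix.specialUnitaryGroup (Fin 2) ℂ) : Matrix (Fin 2) (Fin 2) ℂ) * quatVec (toLp 2 ![0, (fun q : Edge d L × Fin 3 => κ * fderiv ℝ (fun p : ((Edge d L × Fin 3) → ℝ) => St ((fun ℓ : Edge d L => gaussUnit (toLp 2
          ![Real.cos (c * Real.sqrt (p (ℓ, 0) ^ 2 + p (ℓ, 1) ^ 2 + p (ℓ, 2) ^ 2)),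
            c * Real.sinc (c * Real.sqrt (p (ℓ, 0) ^ 2 + p (ℓ, 1) ^ 2 + p (ℓ, 2) ^ 2)) * p (ℓ, 0),
            c * Real.sinc (c * Real.sqrt (p (ℓ, 0) ^ 2 + p (ℓ, 1) ^ 2 + p (ℓ, 2) ^ 2)) * p (ℓ, 1),
            c * Real.sinc (c * Real.sqrt (p (ℓ, 0) ^ 2 + p (ℓ, 1) ^ 2 + p (ℓ, 2) ^ 2)) * p (ℓ, 2)])) * V)) 0 (Pi.single q 1)) (q.1, 0), (fun q : Edge d L × Fin 3 => κ * fderiv ℝ (fun p : ((Edge d L × Fin 3) → ℝ) => St ((fun ℓ : Edge d L => gaussUnit (toLp 2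
          ![Real.cos (c * Real.sqrt (p (ℓ, 0) ^ 2 + p (ℓ, 1) ^ 2 + p (ℓ, 2) ^ 2)),
            c * Real.sinc (c * Real.sqrt (p (ℓ, 0) ^ 2 + p (ℓ, 1) ^ 2 + p (ℓ, 2) ^ 2)) * p (ℓ, 0),
            c * Real.sinc (c * Real.sqrt (p (ℓ, 0) ^ 2 + p (ℓ, 1) ^ 2 + p (ℓ, 2) ^ 2)) * p (ℓ, 1),
            c * Real.sinc (c * Real.sqrt (p (ℓ, 0) ^ 2 + p (ℓ, 1) ^ 2 + p (ℓ, 2) ^ 2)) * p (ℓ, 2)])) * V)) 0 (Pi.single q 1)) (q.1, 1), (fun q : Edge d L × Fin 3 => κ * fderiv ℝ (fun p : ((Edge d L × Fin 3) → ℝ) => St ((fun ℓ : Edge d L => gaussUnit (toLp 2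
          ![Real.cos (c * Real.sqrt (p (ℓ, 0) ^ 2 + p (ℓ, 1) ^ 2 + p (ℓ, 2) ^ 2)),
            c * Real.sinc (c * Real.sqrt (p (ℓ, 0) ^ 2 + p (ℓ, 1) ^ 2 + p (ℓ, 2) ^ 2)) * p (ℓ, 0),
            c * Real.sinc (c * Real.sqrt (p (ℓ, 0) ^ 2 + p (ℓ, 1) ^ 2 + p (ℓ, 2) ^ 2)) * p (ℓ, 1),
            c * Real.sinc (c * Real.sqrt (p (ℓ, 0) ^ 2 + p (ℓ, 1) ^ 2 + p (ℓ, 2) ^ 2)) * p (ℓ, 2)])) * V)) 0 (Pi.single q 1)) (q.1, 2)]) * (((h q.1.1 : Matrix.specialUnitaryGroup (Fin 2) ℂ) : Matrix (Fin 2) (Fin 2) ℂ))ᴴ)) q.2.succ) := by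
  -- `R_{h⁻¹}` as a continuous linear equivalence
  let Le : ((Edge d L × Fin 3) → ℝ) ≃ₗ[ℝ] ((Edge d L × Fin 3) → ℝ) :=
    { toFun := fun p => (fun q : Edge d L × Fin 3 => (vecQuat (((h⁻¹ q.1.1 : Matrix.specialUnitaryGroup (Fin 2) ℂ) : Matrix (Fin 2) (Fin 2) ℂ) * quatVec (toLp 2 ![0, p (q.1, 0), p (q.1, 1), p (q.1, 2)]) * (((h⁻¹ q.1.1 : Matrix.specialUnitaryGroup (Fin 2) ℂ) : Matrix (Fin 2) (Fin 2) ℂ))ᴴ)) q.2.succ)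
      invFun := fun p => (fun q : Edge d L × Fin 3 => (vecQuat (((h q.1.1 : Matrix.specialUnitaryGroup (Fin 2) ℂ) : Matrix (Fin 2) (Fin 2) ℂ) * quatVec (toLp 2 ![0, p (q.1, 0), p (q.1, 1), p (q.1, 2)]) * (((h q.1.1 : Matrix.specialUnitaryGroup (Fin 2) ℂ) : Matrix (Fin 2) (Fin 2) ℂ))ᴴ)) q.2.succ)
      map_add' := fun p p' => su2MomRot_add h⁻¹ p p'
      map_smul' := fun a p => su2MomRot_smul h⁻¹ a p
      left_inv := fun p => su2MomRot_inv_right h p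
      right_inv := fun p => su2MomRot_inv_left h p }
  let Lc : ((Edge d L × Fin 3) → ℝ) ≃L[ℝ] ((Edge d L × Fin 3) → ℝ) := Le.toContinuousLinearEquiv
  have hLc : ∀ p : ((Edge d L × Fin 3) → ℝ), Lc p = (fun q : Edge d L × Fin 3 => (vecQuat (((h⁻¹ q.1.1 : Matrix.specialUnitaryGroup (Fin 2) ℂ) : Matrix (Fin 2) (Fin 2) ℂ) * quatVec (toLp 2 ![0, p (q.1, 0), p (q.1, 1), p (q.1, 2)]) * (((h⁻¹ q.1.1 : Matrix.specialUnitaryGroup (Fin 2) ℂ) : Matrix (Fin 2) (Fin 2) ℂ))ᴴ)) q.2.succ) := fun p => rfl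
  have hcomp : (fun p : ((Edge d L × Fin 3) → ℝ) => St ((fun ℓ : Edge d L => gaussUnit (toLp 2
          ![Real.cos (c * Real.sqrt (p (ℓ, 0) ^ 2 + p (ℓ, 1) ^ 2 + p (ℓ, 2) ^ 2)),
            c * Real.sinc (c * Real.sqrt (p (ℓ, 0) ^ 2 + p (ℓ, 1) ^ 2 + p (ℓ, 2) ^ 2)) * p (ℓ, 0),
            c * Real.sinc (c * Real.sqrt (p (ℓ, 0) ^ 2 + p (ℓ, 1) ^ 2 + p (ℓ, 2) ^ 2)) * p (ℓ, 1),
            c * Real.sinc (c * Real.sqrt (p (ℓ, 0) ^ 2 + p (ℓ, 1) ^ 2 + p (ℓ, 2) ^ 2)) * p (ℓ, 2)])) * gaugeTransform h V)) =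
      (fun p : ((Edge d L × Fin 3) → ℝ) => St ((fun ℓ : Edge d L => gaussUnit (toLp 2
          ![Real.cos (c * Real.sqrt (p (ℓ, 0) ^ 2 + p (ℓ, 1) ^ 2 + p (ℓ, 2) ^ 2)),
            c * Real.sinc (c * Real.sqrt (p (ℓ, 0) ^ 2 + p (ℓ, 1) ^ 2 + p (ℓ, 2) ^ 2)) * p (ℓ, 0),
            c * Real.sinc (c * Real.sqrt (p (ℓ, 0) ^ 2 + p (ℓ, 1) ^ 2 + p (ℓ, 2) ^ 2)) * p (ℓ, 1),
            c * Real.sinc (c * Real.sqrt (p (ℓ, 0) ^ 2 + p (ℓ, 1) ^ 2 + p (ℓ, 2) ^ 2)) * p (ℓ, 2)])) * V)) ∘ (⇑Lc) := by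
    rw [ftAction_drift_gaugeTransform h hSt c V]
    rfl
  have hD : ∀ a : Edge d L × Fin 3, fderiv ℝ (fun p : ((Edge d L × Fin 3) → ℝ) => St ((fun ℓ : Edge d L => gaussUnit (toLp 2
          ![Real.cos (c * Real.sqrt (p (ℓ, 0) ^ 2 + p (ℓ, 1) ^ 2 + p (ℓ, 2) ^ 2)),
            c * Real.sinc (c * Real.sqrt (p (ℓ, 0) ^ 2 + p (ℓ, 1) ^ 2 + p (ℓ, 2) ^ 2)) * p (ℓ, 0),
            c * Real.sinc (c * Real.sqrt (p (ℓ, 0) ^ 2 + p (ℓ, 1) ^ 2 + p (ℓ, 2) ^ 2)) * p (ℓ, 1),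
            c * Real.sinc (c * Real.sqrt (p (ℓ, 0) ^ 2 + p (ℓ, 1) ^ 2 + p (ℓ, 2) ^ 2)) * p (ℓ, 2)])) * gaugeTransform h V)) 0 (Pi.single a 1) =
      ∑ b : Edge d L × Fin 3, vecQuat (((h a.1.1 : Matrix.specialUnitaryGroup (Fin 2) ℂ) : Matrix (Fin 2) (Fin 2) ℂ) * quatVec (toLp 2 ![0, (Pi.single b (1 : ℝ) : ((Edge d L × Fin 3) → ℝ)) (a.1, 0), (Pi.single b (1 : ℝ) : ((Edge d L × Fin 3) → ℝ)) (a.1, 1), (Pi.single b (1 : ℝ) : ((Edge d L × Fin 3) → ℝ)) (a.1, 2)]) * (((h a.1.1 : Matrix.specialUnitaryGroup (Fin 2) ℂ) : Matrix (Fin 2) (Fin 2) ℂ))ᴴ) a.2.succ *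
        fderiv ℝ (fun p : ((Edge d L × Fin 3) → ℝ) => St ((fun ℓ : Edge d L => gaussUnit (toLp 2
          ![Real.cos (c * Real.sqrt (p (ℓ, 0) ^ 2 + p (ℓ, 1) ^ 2 + p (ℓ, 2) ^ 2)),
            c * Real.sinc (c * Real.sqrt (p (ℓ, 0) ^ 2 + p (ℓ, 1) ^ 2 + p (ℓ, 2) ^ 2)) * p (ℓ, 0),
            c * Real.sinc (c * Real.sqrt (p (ℓ, 0) ^ 2 + p (ℓ, 1) ^ 2 + p (ℓ, 2) ^ 2)) * p (ℓ, 1),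
            c * Real.sinc (c * Real.sqrt (p (ℓ, 0) ^ 2 + p (ℓ, 1) ^ 2 + p (ℓ, 2) ^ 2)) * p (ℓ, 2)])) * V)) 0 (Pi.single b 1) := by
    intro a
    rw [hcomp, Lc.comp_right_fderiv, ContinuousLinearEquiv.map_zero, ContinuousLinearMap.comp_apply]
    change fderiv ℝ (fun p : ((Edge d L × Fin 3) → ℝ) => St ((fun ℓ : Edge d L => gaussUnit (toLp 2
          ![Real.cos (c * Real.sqrt (p (ℓ, 0) ^ 2 + p (ℓ, 1) ^ 2 + p (ℓ, 2) ^ 2)),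
            c * Real.sinc (c * Real.sqrt (p (ℓ, 0) ^ 2 + p (ℓ, 1) ^ 2 + p (ℓ, 2) ^ 2)) * p (ℓ, 0),
            c * Real.sinc (c * Real.sqrt (p (ℓ, 0) ^ 2 + p (ℓ, 1) ^ 2 + p (ℓ, 2) ^ 2)) * p (ℓ, 1),
            c * Real.sinc (c * Real.sqrt (p (ℓ, 0) ^ 2 + p (ℓ, 1) ^ 2 + p (ℓ, 2) ^ 2)) * p (ℓ, 2)])) * V)) 0 (Lc (Pi.single a 1)) = _
    rw [hLc, pi_eq_sum_univ' ((fun q : Edge d L × Fin 3 => (vecQuat (((h⁻¹ q.1.1 : Matrix.specialUnitaryGroup (Fin 2) ℂ) : Matrix (Fin 2) (Fin 2) ℂ) * quatVec (toLp 2 ![0, (Pi.single a (1 : ℝ) : ((Edge d L × Fin 3) → ℝ)) (q.1, 0), (Pi.single a (1 : ℝ) : ((Edge d L × Fin 3) → ℝ)) (q.1, 1), (Pi.single a (1 : ℝ) : ((Edge d L × Fin 3) → ℝ)) (q.1, 2)]) * (((h⁻¹ q.1.1 : Matrix.specialUnitaryGroup (Fin 2) ℂ) : Matrix (Fin 2)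 (Fin 2) ℂ))ᴴ)) q.2.succ)), map_sum]
    refine Finset.sum_congr rfl fun b _ => ?_
    rw [map_smul, smul_eq_mul, su2MomRot_inv_single h a b]
  funext a
  beta_reduce
  rw [su2MomRot_apply_eq_sum h (fun q : Edge d L × Fin 3 => κ * fderiv ℝ (fun p : ((Edge d L × Fin 3) → ℝ) => St ((fun ℓ : Edge d L => gaussUnit (toLp 2
          ![Real.cos (c * Real.sqrt (p (ℓ, 0) ^ 2 + p (ℓ, 1) ^ 2 + p (ℓ, 2) ^ 2)),
            c * Real.sinc (c * Real.sqrt (p (ℓ, 0) ^ 2 + p (ℓ, 1) ^ 2 + p (ℓ, 2) ^ 2)) * p (ℓ, 0),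
            c * Real.sinc (c * Real.sqrt (p (ℓ, 0) ^ 2 + p (ℓ, 1) ^ 2 + p (ℓ, 2) ^ 2)) * p (ℓ, 1),
            c * Real.sinc (c * Real.sqrt (p (ℓ, 0) ^ 2 + p (ℓ, 1) ^ 2 + p (ℓ, 2) ^ 2)) * p (ℓ, 2)])) * V)) 0 (Pi.single q 1)) a, hD a, Finset.mul_sum]
  refine Finset.sum_congr rfl fun b _ => ?_
  ring

omit [NeZero L] in
/-- The engine's drift `p ↦ (ℓ ↦ exp(c p_ℓ))` is continuous (the closed-form point has unit norm,
where `gaussUnit` is continuous). -/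
theorem continuous_su2Drift (c : ℝ) :
    Continuous fun p : ((Edge d L × Fin 3) → ℝ) => (fun ℓ : Edge d L => gaussUnit (toLp 2
          ![Real.cos (c * Real.sqrt (p (ℓ, 0) ^ 2 + p (ℓ, 1) ^ 2 + p (ℓ, 2) ^ 2)),
            c * Real.sinc (c * Real.sqrt (p (ℓ, 0) ^ 2 + p (ℓ, 1) ^ 2 + p (ℓ, 2) ^ 2)) * p (ℓ, 0),
            c * Real.sinc (c * Real.sqrt (p (ℓ, 0) ^ 2 + p (ℓ, 1) ^ 2 + p (ℓ, 2) ^ 2)) * p (ℓ, 1),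
            c * Real.sinc (c * Real.sqrt (p (ℓ, 0) ^ 2 + p (ℓ, 1) ^ 2 + p (ℓ, 2) ^ 2)) * p (ℓ, 2)])) := by
  refine continuous_pi fun ℓ => ?_
  have hr : Continuous fun p : ((Edge d L × Fin 3) → ℝ) => Real.sqrt (p (ℓ, 0) ^ 2 + p (ℓ, 1) ^ 2 + p (ℓ, 2) ^ 2) := by
    fun_prop
  have hs : Continuous fun p : ((Edge d L × Fin 3) → ℝ) => c * Real.sinc (c * Real.sqrt (p (ℓ, 0) ^ 2 + p (ℓ, 1) ^ 2 + p (ℓ, 2) ^ 2)) :=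
    continuous_const.mul (Real.continuous_sinc.comp (continuous_const.mul hr))
  have hv : Continuous fun p : ((Edge d L × Fin 3) → ℝ) => (toLp 2
          ![Real.cos (c * Real.sqrt (p (ℓ, 0) ^ 2 + p (ℓ, 1) ^ 2 + p (ℓ, 2) ^ 2)),
            c * Real.sinc (c * Real.sqrt (p (ℓ, 0) ^ 2 + p (ℓ, 1) ^ 2 + p (ℓ, 2) ^ 2)) * p (ℓ, 0),
            c * Real.sinc (c * Real.sqrt (p (ℓ, 0) ^ 2 + p (ℓ, 1) ^ 2 + p (ℓ, 2) ^ 2)) * p (ℓ, 1),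
            c * Real.sinc (c * Real.sqrt (p (ℓ, 0) ^ 2 + p (ℓ, 1) ^ 2 + p (ℓ, 2) ^ 2)) * p (ℓ, 2)] : R4) := by
    refine (PiLp.continuous_toLp 2 _).comp (continuous_pi fun i => ?_)
    fin_cases i
    · exact Real.continuous_cos.comp (continuous_const.mul hr)
    · exact hs.mul (continuous_apply _)
    · exact hs.mul (continuous_apply _)
    · exact hs.mul (continuous_apply _)
  refine continuousOn_gaussUnit.comp_continuous hv fun p => ?_
  rw [Set.mem_compl_iff, Set.mem_singleton_iff, ← norm_eq_zero,
    norm_closedForm_eq_one c (p (ℓ, 0)) (p (ℓ, 1)) (p (ℓ, 2))]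
  exact one_ne_zero

/-- **The exact force routine is measurable in the field** for every CONTINUOUS action `S̃`
(`measurable_fderiv_apply_const_with_param`: the derivative in `p` of the jointly continuous
`(V, p) ↦ S̃(exp(c p) · V)`, at `p = 0`). -/
theorem measurable_su2ExactForce {St : GaugeConfig d L (Matrix.specialUnitaryGroup (Fin 2) ℂ) → ℝ} (hSt : Continuous St) (c κ : ℝ) :
    Measurable fun V : GaugeConfig d L (Matrix.specialUnitaryGroup (Fin 2) ℂ) => (fun q : Edge d L × Fin 3 => κ * fderiv ℝ (fun p : ((Edge d L × Fin 3) → ℝ) => St ((fun ℓ : Edge d L => gaussUnit (toLp 2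
          ![Real.cos (c * Real.sqrt (p (ℓ, 0) ^ 2 + p (ℓ, 1) ^ 2 + p (ℓ, 2) ^ 2)),
            c * Real.sinc (c * Real.sqrt (p (ℓ, 0) ^ 2 + p (ℓ, 1) ^ 2 + p (ℓ, 2) ^ 2)) * p (ℓ, 0),
            c * Real.sinc (c * Real.sqrt (p (ℓ, 0) ^ 2 + p (ℓ, 1) ^ 2 + p (ℓ, 2) ^ 2)) * p (ℓ, 1),
            c * Real.sinc (c * Real.sqrt (p (ℓ, 0) ^ 2 + p (ℓ, 1) ^ 2 + p (ℓ, 2) ^ 2)) * p (ℓ, 2)])) * V)) 0 (Pi.single q 1)) := by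
  refine measurable_pi_lambda _ fun q => ?_
  have hmul : Continuous fun P : GaugeConfig d L (Matrix.specialUnitaryGroup (Fin 2) ℂ) × ((Edge d L × Fin 3) → ℝ) =>
      (fun ℓ : Edge d L => gaussUnit (toLp 2
          ![Real.cos (c * Real.sqrt (P.2 (ℓ, 0) ^ 2 + P.2 (ℓ, 1) ^ 2 + P.2 (ℓ, 2) ^ 2)),
            c * Real.sinc (c * Real.sqrt (P.2 (ℓ, 0) ^ 2 + P.2 (ℓ, 1) ^ 2 + P.2 (ℓ, 2) ^ 2)) * P.2 (ℓ, 0),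
            c * Real.sinc (c * Real.sqrt (P.2 (ℓ, 0) ^ 2 + P.2 (ℓ, 1) ^ 2 + P.2 (ℓ, 2) ^ 2)) * P.2 (ℓ, 1),
            c * Real.sinc (c * Real.sqrt (P.2 (ℓ, 0) ^ 2 + P.2 (ℓ, 1) ^ 2 + P.2 (ℓ, 2) ^ 2)) * P.2 (ℓ, 2)])) * P.1 :=
    ((continuous_su2Drift (d := d) (L := L) c).comp continuous_snd).mul continuous_fst
  have hf : Continuous (Function.uncurry fun (V : GaugeConfig d L (Matrix.specialUnitaryGroup (Fin 2) ℂ)) (p : ((Edge d L × Fin 3) → ℝ)) => St ((fun ℓ : Edge d L => gaussUnit (toLp 2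
          ![Real.cos (c * Real.sqrt (p (ℓ, 0) ^ 2 + p (ℓ, 1) ^ 2 + p (ℓ, 2) ^ 2)),
            c * Real.sinc (c * Real.sqrt (p (ℓ, 0) ^ 2 + p (ℓ, 1) ^ 2 + p (ℓ, 2) ^ 2)) * p (ℓ, 0),
            c * Real.sinc (c * Real.sqrt (p (ℓ, 0) ^ 2 + p (ℓ, 1) ^ 2 + p (ℓ, 2) ^ 2)) * p (ℓ, 1),
            c * Real.sinc (c * Real.sqrt (p (ℓ, 0) ^ 2 + p (ℓ, 1) ^ 2 + p (ℓ, 2) ^ 2)) * p (ℓ, 2)])) * V)) := by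
    change Continuous fun P : GaugeConfig d L (Matrix.specialUnitaryGroup (Fin 2) ℂ) × ((Edge d L × Fin 3) → ℝ) => St ((fun ℓ : Edge d L => gaussUnit (toLp 2
          ![Real.cos (c * Real.sqrt (P.2 (ℓ, 0) ^ 2 + P.2 (ℓ, 1) ^ 2 + P.2 (ℓ, 2) ^ 2)),
            c * Real.sinc (c * Real.sqrt (P.2 (ℓ, 0) ^ 2 + P.2 (ℓ, 1) ^ 2 + P.2 (ℓ, 2) ^ 2)) * P.2 (ℓ, 0),
            c * Real.sinc (c * Real.sqrt (P.2 (ℓ, 0) ^ 2 + P.2 (ℓ, 1) ^ 2 + P.2 (ℓ, 2) ^ 2)) * P.2 (ℓ, 1),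
            c * Real.sinc (c * Real.sqrt (P.2 (ℓ, 0) ^ 2 + P.2 (ℓ, 1) ^ 2 + P.2 (ℓ, 2) ^ 2)) * P.2 (ℓ, 2)])) * P.1)
    exact hSt.comp hmul
  have hm : Measurable fun P : GaugeConfig d L (Matrix.specialUnitaryGroup (Fin 2) ℂ) × ((Edge d L × Fin 3) → ℝ) =>
      fderiv ℝ (fun p : ((Edge d L × Fin 3) → ℝ) => St ((fun ℓ : Edge d L => gaussUnit (toLp 2
          ![Real.cos (c * Real.sqrt (p (ℓ, 0) ^ 2 + p (ℓ, 1) ^ 2 + p (ℓ, 2) ^ 2)),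
            c * Real.sinc (c * Real.sqrt (p (ℓ, 0) ^ 2 + p (ℓ, 1) ^ 2 + p (ℓ, 2) ^ 2)) * p (ℓ, 0),
            c * Real.sinc (c * Real.sqrt (p (ℓ, 0) ^ 2 + p (ℓ, 1) ^ 2 + p (ℓ, 2) ^ 2)) * p (ℓ, 1),
            c * Real.sinc (c * Real.sqrt (p (ℓ, 0) ^ 2 + p (ℓ, 1) ^ 2 + p (ℓ, 2) ^ 2)) * p (ℓ, 2)])) * P.1)) P.2 (Pi.single q 1) :=
    measurable_fderiv_apply_const_with_param ℝ hf (Pi.single q 1)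
  have hk : Measurable fun V : GaugeConfig d L (Matrix.specialUnitaryGroup (Fin 2) ℂ) => (V, (0 : ((Edge d L × Fin 3) → ℝ))) := measurable_id.prodMk measurable_const
  have h5 := hm.comp hk
  have h6 : Measurable fun V : GaugeConfig d L (Matrix.specialUnitaryGroup (Fin 2) ℂ) =>
      fderiv ℝ (fun p : ((Edge d L × Fin 3) → ℝ) => St ((fun ℓ : Edge d L => gaussUnit (toLp 2
          ![Real.cos (c * Real.sqrt (p (ℓ, 0) ^ 2 + p (ℓ, 1) ^ 2 + p (ℓ, 2) ^ 2)),
            c * Real.sinc (c * Real.sqrt (p (ℓ, 0) ^ 2 + p (ℓ, 1) ^ 2 + p (ℓ, 2) ^ 2)) * p (ℓ, 0),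
            c * Real.sinc (c * Real.sqrt (p (ℓ, 0) ^ 2 + p (ℓ, 1) ^ 2 + p (ℓ, 2) ^ 2)) * p (ℓ, 1),
            c * Real.sinc (c * Real.sqrt (p (ℓ, 0) ^ 2 + p (ℓ, 1) ^ 2 + p (ℓ, 2) ^ 2)) * p (ℓ, 2)])) * V)) 0 (Pi.single q 1) := by
    exact h5
  exact h6.const_mul κ

end Force

/-! ## FT-HMC with the exact-gradient force routine commutes with every gauge transformation -/

section Kernel

variable {d L : ℕ} [NeZero L]

/-- **The engine's `SU(2)` FT-HMC kernel driven by the EXACT force of the pulled-back action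
commutes with every gauge transformation — no hypothesis on the force left.**  Member
`F : GaugeConfig ≃ᵐ GaugeConfig` gauge equivariant, booked density `J` gauge invariant and
measurable, action `S` gauge invariant and measurable, pulled-back action `S̃ = S∘F − log J`
continuous; force routine `g_κ V (q) = κ · fderiv ℝ (p ↦ S̃(exp(c p) · V)) 0 (e_q)` (any `κ`);
any `c`, `n`, `h`.  Then `conjKernel K Θ_h = K`. -/
theorem su2_fthmc_exactForce_conjKernel_gaugeTransform (h : Site d L → Matrix.specialUnitaryGroup (Fin 2) ℂ)
    (F : GaugeConfig d L (Matrix.specialUnitaryGroup (Fin 2) ℂ) ≃ᵐ GaugeConfig d L (Matrix.specialUnitaryGroup (Fin 2) ℂ)) (hF : IsGaugeEquivariant (⇑F))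
    {J : GaugeConfig d L (Matrix.specialUnitaryGroup (Fin 2) ℂ) → ℝ} (hJm : Measurable J) (hJ : IsGaugeInvariant J)
    {S : GaugeConfig d L (Matrix.specialUnitaryGroup (Fin 2) ℂ) → ℝ} (hS : Measurable S) (hSi : IsGaugeInvariant S)
    (hSc : Continuous fun W : GaugeConfig d L (Matrix.specialUnitaryGroup (Fin 2) ℂ) => S (F W) - Real.log (J W)) (c κ : ℝ) (n : ℕ) :
    conjKernel
      (conjKernel
        (refreshUpdate
          (involMH
            (⇑((flip : Equiv.Perm (GaugeConfig d L (Matrix.specialUnitaryGroup (Fin 2) ℂ) × ((Edge d L × Fin 3) → ℝ))) *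
                leapfrog (mulDrift fun p : ((Edge d L × Fin 3) → ℝ) =>
                  fun ℓ : Edge d L => gaussUnit (toLp 2
          ![Real.cos (c * Real.sqrt (p (ℓ, 0) ^ 2 + p (ℓ, 1) ^ 2 + p (ℓ, 2) ^ 2)),
            c * Real.sinc (c * Real.sqrt (p (ℓ, 0) ^ 2 + p (ℓ, 1) ^ 2 + p (ℓ, 2) ^ 2)) * p (ℓ, 0),
            c * Real.sinc (c * Real.sqrt (p (ℓ, 0) ^ 2 + p (ℓ, 1) ^ 2 + p (ℓ, 2) ^ 2)) * p (ℓ, 1),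
            c * Real.sinc (c * Real.sqrt (p (ℓ, 0) ^ 2 + p (ℓ, 1) ^ 2 + p (ℓ, 2) ^ 2)) * p (ℓ, 2)])) (fun V : GaugeConfig d L (Matrix.specialUnitaryGroup (Fin 2) ℂ) => (fun q : Edge d L × Fin 3 => κ * fderiv ℝ (fun p : ((Edge d L × Fin 3) → ℝ) => (fun W : GaugeConfig d L (Matrix.specialUnitaryGroup (Fin 2) ℂ) => S (F W) - Real.log (J W)) ((fun ℓ : Edge d L => gaussUnit (toLp 2
          ![Real.cos (c * Real.sqrt (p (ℓ, 0) ^ 2 + p (ℓ, 1) ^ 2 + p (ℓ, 2) ^ 2)),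
            c * Real.sinc (c * Real.sqrt (p (ℓ, 0) ^ 2 + p (ℓ, 1) ^ 2 + p (ℓ, 2) ^ 2)) * p (ℓ, 0),
            c * Real.sinc (c * Real.sqrt (p (ℓ, 0) ^ 2 + p (ℓ, 1) ^ 2 + p (ℓ, 2) ^ 2)) * p (ℓ, 1),
            c * Real.sinc (c * Real.sqrt (p (ℓ, 0) ^ 2 + p (ℓ, 1) ^ 2 + p (ℓ, 2) ^ 2)) * p (ℓ, 2)])) * V)) 0 (Pi.single q 1))) ^ n))
            (measurable_flip_leapfrog_pow (measurable_mulDrift (measurable_su2Drift c)) (measurable_su2ExactForce hSc c κ) n)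
            fun z : GaugeConfig d L (Matrix.specialUnitaryGroup (Fin 2) ℂ) × ((Edge d L × Fin 3) → ℝ) =>
              (S (F z.1) - Real.log (J z.1)) + ∑ i, z.2 i ^ 2 / 2)
          ((((volume : Measure ((Edge d L × Fin 3) → ℝ)).withDensity
                  fun p => ENNReal.ofReal (Real.exp (-(∑ i, p i ^ 2 / 2)))) Set.univ)⁻¹ •
              (volume : Measure ((Edge d L × Fin 3) → ℝ)).withDensity
                fun p => ENNReal.ofReal (Real.exp (-(∑ i, p i ^ 2 / 2)))))
        F)
      (Elitzur.gaugeTransformMEquiv h) =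
      (conjKernel
        (refreshUpdate
          (involMH
            (⇑((flip : Equiv.Perm (GaugeConfig d L (Matrix.specialUnitaryGroup (Fin 2) ℂ) × ((Edge d L × Fin 3) → ℝ))) *
                leapfrog (mulDrift fun p : ((Edge d L × Fin 3) → ℝ) =>
                  fun ℓ : Edge d L => gaussUnit (toLp 2
          ![Real.cos (c * Real.sqrt (p (ℓ, 0) ^ 2 + p (ℓ, 1) ^ 2 + p (ℓ, 2) ^ 2)),
            c * Real.sinc (c * Real.sqrt (p (ℓ, 0) ^ 2 + p (ℓ, 1) ^ 2 + p (ℓ, 2) ^ 2)) * p (ℓ, 0),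
            c * Real.sinc (c * Real.sqrt (p (ℓ, 0) ^ 2 + p (ℓ, 1) ^ 2 + p (ℓ, 2) ^ 2)) * p (ℓ, 1),
            c * Real.sinc (c * Real.sqrt (p (ℓ, 0) ^ 2 + p (ℓ, 1) ^ 2 + p (ℓ, 2) ^ 2)) * p (ℓ, 2)])) (fun V : GaugeConfig d L (Matrix.specialUnitaryGroup (Fin 2) ℂ) => (fun q : Edge d L × Fin 3 => κ * fderiv ℝ (fun p : ((Edge d L × Fin 3) → ℝ) => (fun W : GaugeConfig d L (Matrix.specialUnitaryGroup (Fin 2) ℂ) => S (F W) - Real.log (J W)) ((fun ℓ : Edge d L => gaussUnit (toLp 2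
          ![Real.cos (c * Real.sqrt (p (ℓ, 0) ^ 2 + p (ℓ, 1) ^ 2 + p (ℓ, 2) ^ 2)),
            c * Real.sinc (c * Real.sqrt (p (ℓ, 0) ^ 2 + p (ℓ, 1) ^ 2 + p (ℓ, 2) ^ 2)) * p (ℓ, 0),
            c * Real.sinc (c * Real.sqrt (p (ℓ, 0) ^ 2 + p (ℓ, 1) ^ 2 + p (ℓ, 2) ^ 2)) * p (ℓ, 1),
            c * Real.sinc (c * Real.sqrt (p (ℓ, 0) ^ 2 + p (ℓ, 1) ^ 2 + p (ℓ, 2) ^ 2)) * p (ℓ, 2)])) * V)) 0 (Pi.single q 1))) ^ n))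
            (measurable_flip_leapfrog_pow (measurable_mulDrift (measurable_su2Drift c)) (measurable_su2ExactForce hSc c κ) n)
            fun z : GaugeConfig d L (Matrix.specialUnitaryGroup (Fin 2) ℂ) × ((Edge d L × Fin 3) → ℝ) =>
              (S (F z.1) - Real.log (J z.1)) + ∑ i, z.2 i ^ 2 / 2)
          ((((volume : Measure ((Edge d L × Fin 3) → ℝ)).withDensity
                  fun p => ENNReal.ofReal (Real.exp (-(∑ i, p i ^ 2 / 2)))) Set.univ)⁻¹ •
              (volume : Measure ((Edge d L × Fin 3) → ℝ)).withDensity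
                fun p => ENNReal.ofReal (Real.exp (-(∑ i, p i ^ 2 / 2)))))
        F) :=
  su2_fthmc_conjKernel_gaugeTransform h F hF hJm hJ hS hSi c (measurable_su2ExactForce hSc c κ)
    (fun V => su2ExactForce_gaugeTransform h (isGaugeInvariant_ftAction hSi hF hJ) c κ V) n

end Kernel

end Summit.Ventures.LatticeQCDFlow.Exactness
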